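import Literature.Topology.FourManifolds.LatticeFormsOrthogonalGroupCommutatorsThreeU
import HarnessLib

/-!
# Ten generators for `O(U ⊕ U ⊕ U)`: `SO⁺(3U) = ⟨t(e,e₁), t(e,f₁), t(e,e₂), t(e,f₂), t(f,e₁), t(f,f₁), t(f,e₂), t(f,f₂)⟩`,
# `O⁺(3U) = ⟨those, σ_{e−f}⟩`, `O(3U) = ⟨those, σ_{e−f}, −1_U⟩`
# (Gritsenko–Hulek–Sankaran, *J. Algebra* 322 (2009) §3.1 (t3), §3.3 (16)/(SO) "`E_U(L₁) = ⟨t(c,a) | a ∈ L₁, c = e or f⟩`",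
# §4 "`Õ⁺(L) = ⟨S̃O⁺(L), σ_{e−f}⟩`" — the case `L = 3U`, with `a` running over a basis of `L₁ = U₁ ⊕ U₂`)

Trunk T-4MAN vocabulary. Sequel of `LatticeFormsSpecialOrthogonalEichlerGeneration.lean` (row g49-#7: `SO⁺(3U)` = the admissible
words `E(y,a,q)`, `E(x,a,q)`, `a ∈ L₁`), `LatticeFormsOrthogonalGroupCommutatorsThreeU.lean` (row g49-#9: the cosets of `SO⁺(3U)`
in `O⁺(3U)` and `O(3U)`) and `LatticeFormsTwoHyperbolicPlanesSpecialOrthogonal.lean` (row g49-#4: the same for `2U` with four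
letters). Written for lane `lit-hodgefound` (Track 2 foundations; prover seat `lit-hodgefound-p18`, gen 49, row g49-#11).
THEOREMS ONLY — no definition, no named fact, no instance, no notation.

## Source, verbatim (held text `paper:arxiv-0810.1614`)

§3.1 p. 5 "(t3) `t(e,a)t(e,b) = t(e,a+b)` if `(a,b) = 0`" (in general `E(e,a,q)E(e,b,q′) = E(e,a+b,q+q′+(a,b))`, the tree's
`eichlerTransvection_comp`); §3.3 p. 8 "(SO) `S̃O⁺(L) = O′(L) = E(L) = E_U(L₁) = ⟨{t(c,a) | a ∈ L₁, c = e or f}⟩`"; §4 p. 8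
"`Õ⁺(L) = ⟨S̃O⁺(L), σ_{e−f}⟩`".

## Dictionary and contents (all proved)

`3U = (H ⊕ H) ⊕ H` on `((Fin 2 → ℤ) × (Fin 2 → ℤ)) × (Fin 2 → ℤ)`; the outer plane `U = ⟨e, f⟩ = ⟨hypX, hypY⟩` is the last factor,
`L₁ = U₁ ⊕ U₂ = H ⊕ H` has the isotropic basis `e₁ = (e₀,0)`, `f₁ = (e₁,0)`, `e₂ = (0,e₀)`, `f₂ = (0,e₁)`; Kirby's
`A_w = t(f,w) = E(hypY,(w,0),·)`, `A'_w = t(e,w) = E(hypX,(w,0),·)` (`LatticeFormsWallGenerators`). The EIGHT LETTERS are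
`A_{e₁}, A_{f₁}, A_{e₂}, A_{f₂}, A'_{e₁}, A'_{f₁}, A'_{e₂}, A'_{f₂}`; `σ = 1 ⊕ σ_H` (the `(−2)`-reflection `σ_{e−f}` of the outer
plane) and `ν = 1 ⊕ (−1_H)`.

* §1 by (t3) and `t(c, ka) = t(c,a)^k`: **every `A_w`, `A'_w` (`w ∈ L₁`, `(w,w) = 2q`) is a word in the eight letters**
  (`isWordIn_eightTransvections_transvectionAEquiv`, `…A'Equiv`): `t(f,w) = t(f,w₀e₁) t(f,w₁f₁) t(f,w₂e₂) t(f,w₃f₂)` up to the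
  (t3) parameters.
* §2 every admissible letter and word of g49-#7 is a word in the eight letters (`isWordIn_eightTransvections_evalEquiv`).
* §3 **`SO⁺(3U) = ⟨8 letters⟩`** (`isWordIn_eightTransvections_iff`), **`O⁺(3U) = ⟨8 letters, σ⟩`**
  (`isWordIn_nineGenerators_iff`), **`O(3U) = ⟨8 letters, σ, ν⟩`** (`isWordIn_tenGenerators`) — finite generating sets read
  off (SO), "`Õ⁺ = ⟨S̃O⁺, σ_{e−f}⟩`" and `O = O⁺ ⊔ O⁺ν` (row g49-#9).
-/

noncomputable section

open Module
open LinearMap (BilinForm)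
open LinearMap.BilinForm
open LinearMap.BilinForm (IsometryEquiv)

namespace Literature.Topology.FourManifolds

/-! ### §0 The basis `e₁, f₁, e₂, f₂` of `L₁ = H ⊕ H` -/

section Basis

/-- `(u,v)` on `H ⊕ H` in coordinates. [cite: GritsenkoHulekSankaran2009, §3.2 ("U₁ = ℤe₁ ⊕ ℤf₁")] -/
theorem hyperbolic_prod_hyperbolic_apply (u v : (Fin 2 → ℤ) × (Fin 2 → ℤ)) :
    (hyperbolicForm.prod hyperbolicForm) u v = u.1 0 * v.1 1 + u.1 1 * v.1 0 + (u.2 0 * v.2 1 + u.2 1 * v.2 0) := by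
  rw [prod_apply, hyperbolicForm_apply, hyperbolicForm_apply]

/-- `e₁ = (e₀, 0)` is isotropic. [cite: GritsenkoHulekSankaran2009, §3.2] -/
theorem hyperbolic_prod_hyperbolic_e₁ :
    (hyperbolicForm.prod hyperbolicForm) ((Pi.single 0 1, 0) : (Fin 2 → ℤ) × (Fin 2 → ℤ)) (Pi.single 0 1, 0) = 0 + 0 := by
  rw [hyperbolic_prod_hyperbolic_apply]; simp

/-- `f₁ = (e₁, 0)` is isotropic. [cite: GritsenkoHulekSankaran2009, §3.2] -/
theorem hyperbolic_prod_hyperbolic_f₁ :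
    (hyperbolicForm.prod hyperbolicForm) ((Pi.single 1 1, 0) : (Fin 2 → ℤ) × (Fin 2 → ℤ)) (Pi.single 1 1, 0) = 0 + 0 := by
  rw [hyperbolic_prod_hyperbolic_apply]; simp

/-- `e₂ = (0, e₀)` is isotropic. [cite: GritsenkoHulekSankaran2009, §3.2] -/
theorem hyperbolic_prod_hyperbolic_e₂ :
    (hyperbolicForm.prod hyperbolicForm) ((0, Pi.single 0 1) : (Fin 2 → ℤ) × (Fin 2 → ℤ)) (0, Pi.single 0 1) = 0 + 0 := by
  rw [hyperbolic_prod_hyperbolic_apply]; simp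

/-- `f₂ = (0, e₁)` is isotropic. [cite: GritsenkoHulekSankaran2009, §3.2] -/
theorem hyperbolic_prod_hyperbolic_f₂ :
    (hyperbolicForm.prod hyperbolicForm) ((0, Pi.single 1 1) : (Fin 2 → ℤ) × (Fin 2 → ℤ)) (0, Pi.single 1 1) = 0 + 0 := by
  rw [hyperbolic_prod_hyperbolic_apply]; simp

/-- Coordinates: `w = w₀e₁ + w₁f₁ + w₂e₂ + w₃f₂`, pushed into `3U = L₁ ⊕ U`. [cite: GritsenkoHulekSankaran2009, §3.2] -/
theorem inl_eq_sum_smul_basis (w : (Fin 2 → ℤ) × (Fin 2 → ℤ)) :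
    ((w, 0) : ((Fin 2 → ℤ) × (Fin 2 → ℤ)) × (Fin 2 → ℤ)) =
      (w.1 0) • ((Pi.single 0 1, 0), 0) + ((w.1 1) • ((Pi.single 1 1, 0), 0) +
        ((w.2 0) • ((0, Pi.single 0 1), 0) + (w.2 1) • ((0, Pi.single 1 1), 0))) := by
  refine Prod.ext (Prod.ext (funext fun i ↦ ?_) (funext fun i ↦ ?_)) (funext fun i ↦ ?_) <;> fin_cases i <;> simp

/-- `(w,w) = 2(w₀w₁ + w₂w₃)`, so the parameter `q` of `A_w` is `w₀w₁ + w₂w₃`. [cite: GritsenkoHulekSankaran2009, §3.1 ("q = ½(a,a)")] -/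
theorem eq_of_hyperbolic_prod_hyperbolic_apply_self {w : (Fin 2 → ℤ) × (Fin 2 → ℤ)} {q : ℤ}
    (hw : (hyperbolicForm.prod hyperbolicForm) w w = q + q) : q = w.1 0 * w.1 1 + w.2 0 * w.2 1 := by
  rw [hyperbolic_prod_hyperbolic_apply] at hw
  linarith

end Basis

/-! ### §1 `A_w` and `A'_w` are words in the eight letters -/

section Letters

/-- **`t(f, ka) = t(f,a)^k` inside the eight letters**: for an isotropic basis vector `b` of `L₁` whose letter `A_b` is among
the eight, `E(f, k(b,0), 0)` is a word in the eight letters. [cite: GritsenkoHulekSankaran2009, §3.1 (t3)] -/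
theorem isWordIn_eightTransvections_transvectionA_zsmul (b : (Fin 2 → ℤ) × (Fin 2 → ℤ))
    (hb : (hyperbolicForm.prod hyperbolicForm) b b = 0 + 0)
    (hmem : transvectionAEquiv (isSymm_hyperbolicForm.prod isSymm_hyperbolicForm) b 0 hb ∈
      ({transvectionAEquiv (isSymm_hyperbolicForm.prod isSymm_hyperbolicForm) (Pi.single 0 1, 0) 0 hyperbolic_prod_hyperbolic_e₁,
        transvectionAEquiv (isSymm_hyperbolicForm.prod isSymm_hyperbolicForm) (Pi.single 1 1, 0) 0 hyperbolic_prod_hyperbolic_f₁,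
        transvectionAEquiv (isSymm_hyperbolicForm.prod isSymm_hyperbolicForm) (0, Pi.single 0 1) 0 hyperbolic_prod_hyperbolic_e₂,
        transvectionAEquiv (isSymm_hyperbolicForm.prod isSymm_hyperbolicForm) (0, Pi.single 1 1) 0 hyperbolic_prod_hyperbolic_f₂,
        transvectionA'Equiv (isSymm_hyperbolicForm.prod isSymm_hyperbolicForm) (Pi.single 0 1, 0) 0 hyperbolic_prod_hyperbolic_e₁,
        transvectionA'Equiv (isSymm_hyperbolicForm.prod isSymm_hyperbolicForm) (Pi.single 1 1, 0) 0 hyperbolic_prod_hyperbolic_f₁,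
        transvectionA'Equiv (isSymm_hyperbolicForm.prod isSymm_hyperbolicForm) (0, Pi.single 0 1) 0 hyperbolic_prod_hyperbolic_e₂,
        transvectionA'Equiv (isSymm_hyperbolicForm.prod isSymm_hyperbolicForm) (0, Pi.single 1 1) 0 hyperbolic_prod_hyperbolic_f₂} :
        Set (((hyperbolicForm.prod hyperbolicForm).prod hyperbolicForm).IsometryEquiv
          ((hyperbolicForm.prod hyperbolicForm).prod hyperbolicForm))))
    (k : ℤ) (hk₁ : ((hyperbolicForm.prod hyperbolicForm).prod hyperbolicForm) hypY
      (k • (((b, 0)) : ((Fin 2 → ℤ) × (Fin 2 → ℤ)) × (Fin 2 → ℤ))) = 0)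
    (hk₂ : ((hyperbolicForm.prod hyperbolicForm).prod hyperbolicForm)
      (k • (((b, 0)) : ((Fin 2 → ℤ) × (Fin 2 → ℤ)) × (Fin 2 → ℤ))) (k • ((b, 0))) = 0 + 0) :
    IsWordIn
      {transvectionAEquiv (isSymm_hyperbolicForm.prod isSymm_hyperbolicForm) (Pi.single 0 1, 0) 0 hyperbolic_prod_hyperbolic_e₁,
        transvectionAEquiv (isSymm_hyperbolicForm.prod isSymm_hyperbolicForm) (Pi.single 1 1, 0) 0 hyperbolic_prod_hyperbolic_f₁,
        transvectionAEquiv (isSymm_hyperbolicForm.prod isSymm_hyperbolicForm) (0, Pi.single 0 1) 0 hyperbolic_prod_hyperbolic_e₂,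
        transvectionAEquiv (isSymm_hyperbolicForm.prod isSymm_hyperbolicForm) (0, Pi.single 1 1) 0 hyperbolic_prod_hyperbolic_f₂,
        transvectionA'Equiv (isSymm_hyperbolicForm.prod isSymm_hyperbolicForm) (Pi.single 0 1, 0) 0 hyperbolic_prod_hyperbolic_e₁,
        transvectionA'Equiv (isSymm_hyperbolicForm.prod isSymm_hyperbolicForm) (Pi.single 1 1, 0) 0 hyperbolic_prod_hyperbolic_f₁,
        transvectionA'Equiv (isSymm_hyperbolicForm.prod isSymm_hyperbolicForm) (0, Pi.single 0 1) 0 hyperbolic_prod_hyperbolic_e₂,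
        transvectionA'Equiv (isSymm_hyperbolicForm.prod isSymm_hyperbolicForm) (0, Pi.single 1 1) 0 hyperbolic_prod_hyperbolic_f₂}
      (LinearMap.BilinForm.IsometryEquiv.eichlerTransvection ((hyperbolicForm.prod hyperbolicForm).prod hyperbolicForm)
        ((isSymm_hyperbolicForm.prod isSymm_hyperbolicForm).prod isSymm_hyperbolicForm) hypY (k • ((b, 0))) 0
        prod_prod_hyperbolic_hypY_hypY hk₁ hk₂) := by
  have hB : ((hyperbolicForm.prod hyperbolicForm).prod hyperbolicForm).IsSymm :=
    (isSymm_hyperbolicForm.prod isSymm_hyperbolicForm).prod isSymm_hyperbolicForm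
  have hyb : ((hyperbolicForm.prod hyperbolicForm).prod hyperbolicForm) hypY ((b, 0)) = 0 :=
    prod_hyperbolic_hypY_inl _ b
  have hbb : ((hyperbolicForm.prod hyperbolicForm).prod hyperbolicForm) ((b, 0)) ((b, 0)) = 0 + 0 := by
    rw [prod_hyperbolic_inl_inl, hb]
  refine (isWordIn_eichlerTransvection_zsmul hB prod_prod_hyperbolic_hypY_hypY hyb hbb k hk₁ hk₂).bind fun s hs ↦ ?_
  rw [Set.mem_singleton_iff.1 hs]
  exact IsWordIn.of_mem hmem

/-- The same for the letters `A'_b = t(e, b)` based at `e = hypX`. [cite: GritsenkoHulekSankaran2009, §3.1 (t3)] -/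
theorem isWordIn_eightTransvections_transvectionA'_zsmul (b : (Fin 2 → ℤ) × (Fin 2 → ℤ))
    (hb : (hyperbolicForm.prod hyperbolicForm) b b = 0 + 0)
    (hmem : transvectionA'Equiv (isSymm_hyperbolicForm.prod isSymm_hyperbolicForm) b 0 hb ∈
      ({transvectionAEquiv (isSymm_hyperbolicForm.prod isSymm_hyperbolicForm) (Pi.single 0 1, 0) 0 hyperbolic_prod_hyperbolic_e₁,
        transvectionAEquiv (isSymm_hyperbolicForm.prod isSymm_hyperbolicForm) (Pi.single 1 1, 0) 0 hyperbolic_prod_hyperbolic_f₁,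
        transvectionAEquiv (isSymm_hyperbolicForm.prod isSymm_hyperbolicForm) (0, Pi.single 0 1) 0 hyperbolic_prod_hyperbolic_e₂,
        transvectionAEquiv (isSymm_hyperbolicForm.prod isSymm_hyperbolicForm) (0, Pi.single 1 1) 0 hyperbolic_prod_hyperbolic_f₂,
        transvectionA'Equiv (isSymm_hyperbolicForm.prod isSymm_hyperbolicForm) (Pi.single 0 1, 0) 0 hyperbolic_prod_hyperbolic_e₁,
        transvectionA'Equiv (isSymm_hyperbolicForm.prod isSymm_hyperbolicForm) (Pi.single 1 1, 0) 0 hyperbolic_prod_hyperbolic_f₁,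
        transvectionA'Equiv (isSymm_hyperbolicForm.prod isSymm_hyperbolicForm) (0, Pi.single 0 1) 0 hyperbolic_prod_hyperbolic_e₂,
        transvectionA'Equiv (isSymm_hyperbolicForm.prod isSymm_hyperbolicForm) (0, Pi.single 1 1) 0 hyperbolic_prod_hyperbolic_f₂} :
        Set (((hyperbolicForm.prod hyperbolicForm).prod hyperbolicForm).IsometryEquiv
          ((hyperbolicForm.prod hyperbolicForm).prod hyperbolicForm))))
    (k : ℤ) (hk₁ : ((hyperbolicForm.prod hyperbolicForm).prod hyperbolicForm) hypX
      (k • (((b, 0)) : ((Fin 2 → ℤ) × (Fin 2 → ℤ)) × (Fin 2 → ℤ))) = 0)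
    (hk₂ : ((hyperbolicForm.prod hyperbolicForm).prod hyperbolicForm)
      (k • (((b, 0)) : ((Fin 2 → ℤ) × (Fin 2 → ℤ)) × (Fin 2 → ℤ))) (k • ((b, 0))) = 0 + 0) :
    IsWordIn
      {transvectionAEquiv (isSymm_hyperbolicForm.prod isSymm_hyperbolicForm) (Pi.single 0 1, 0) 0 hyperbolic_prod_hyperbolic_e₁,
        transvectionAEquiv (isSymm_hyperbolicForm.prod isSymm_hyperbolicForm) (Pi.single 1 1, 0) 0 hyperbolic_prod_hyperbolic_f₁,
        transvectionAEquiv (isSymm_hyperbolicForm.prod isSymm_hyperbolicForm) (0, Pi.single 0 1) 0 hyperbolic_prod_hyperbolic_e₂,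
        transvectionAEquiv (isSymm_hyperbolicForm.prod isSymm_hyperbolicForm) (0, Pi.single 1 1) 0 hyperbolic_prod_hyperbolic_f₂,
        transvectionA'Equiv (isSymm_hyperbolicForm.prod isSymm_hyperbolicForm) (Pi.single 0 1, 0) 0 hyperbolic_prod_hyperbolic_e₁,
        transvectionA'Equiv (isSymm_hyperbolicForm.prod isSymm_hyperbolicForm) (Pi.single 1 1, 0) 0 hyperbolic_prod_hyperbolic_f₁,
        transvectionA'Equiv (isSymm_hyperbolicForm.prod isSymm_hyperbolicForm) (0, Pi.single 0 1) 0 hyperbolic_prod_hyperbolic_e₂,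
        transvectionA'Equiv (isSymm_hyperbolicForm.prod isSymm_hyperbolicForm) (0, Pi.single 1 1) 0 hyperbolic_prod_hyperbolic_f₂}
      (LinearMap.BilinForm.IsometryEquiv.eichlerTransvection ((hyperbolicForm.prod hyperbolicForm).prod hyperbolicForm)
        ((isSymm_hyperbolicForm.prod isSymm_hyperbolicForm).prod isSymm_hyperbolicForm) hypX (k • ((b, 0))) 0
        prod_prod_hyperbolic_hypX_hypX hk₁ hk₂) := by
  have hB : ((hyperbolicForm.prod hyperbolicForm).prod hyperbolicForm).IsSymm :=
    (isSymm_hyperbolicForm.prod isSymm_hyperbolicForm).prod isSymm_hyperbolicForm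
  have hxb : ((hyperbolicForm.prod hyperbolicForm).prod hyperbolicForm) hypX ((b, 0)) = 0 :=
    prod_hyperbolic_hypX_inl _ b
  have hbb : ((hyperbolicForm.prod hyperbolicForm).prod hyperbolicForm) ((b, 0)) ((b, 0)) = 0 + 0 := by
    rw [prod_hyperbolic_inl_inl, hb]
  refine (isWordIn_eichlerTransvection_zsmul hB prod_prod_hyperbolic_hypX_hypX hxb hbb k hk₁ hk₂).bind fun s hs ↦ ?_
  rw [Set.mem_singleton_iff.1 hs]
  exact IsWordIn.of_mem hmem

/-- The four multiples `k(b,0)` are orthogonal to `hypY`, `hypX` and isotropic (bookkeeping for (t3)).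
[cite: GritsenkoHulekSankaran2009, §3.1 (t3)] -/
theorem threeU_smul_inl_ortho (k : ℤ) (b : (Fin 2 → ℤ) × (Fin 2 → ℤ)) (hb : (hyperbolicForm.prod hyperbolicForm) b b = 0 + 0) :
    ((hyperbolicForm.prod hyperbolicForm).prod hyperbolicForm) hypY (k • (((b, 0)) : ((Fin 2 → ℤ) × (Fin 2 → ℤ)) × (Fin 2 → ℤ))) = 0 ∧
    ((hyperbolicForm.prod hyperbolicForm).prod hyperbolicForm) hypX (k • (((b, 0)) : ((Fin 2 → ℤ) × (Fin 2 → ℤ)) × (Fin 2 → ℤ))) = 0 ∧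
    ((hyperbolicForm.prod hyperbolicForm).prod hyperbolicForm) (k • (((b, 0)) : ((Fin 2 → ℤ) × (Fin 2 → ℤ)) × (Fin 2 → ℤ)))
      (k • ((b, 0))) = 0 + 0 := by
  refine ⟨?_, ?_, ?_⟩
  · rw [map_smul, prod_hyperbolic_hypY_inl, smul_zero]
  · rw [map_smul, prod_hyperbolic_hypX_inl, smul_zero]
  · simp only [map_smul, LinearMap.smul_apply, smul_eq_mul, prod_hyperbolic_inl_inl, hb, add_zero, mul_zero]

/-- The (t3) parameters along the basis: `(k(b,0), k′(b′,0)) = kk′(b,b′)`. [cite: GritsenkoHulekSankaran2009, §3.1 (t3)] -/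
theorem threeU_smul_inl_smul_inl (k k' : ℤ) (b b' : (Fin 2 → ℤ) × (Fin 2 → ℤ)) :
    ((hyperbolicForm.prod hyperbolicForm).prod hyperbolicForm) (k • (((b, 0)) : ((Fin 2 → ℤ) × (Fin 2 → ℤ)) × (Fin 2 → ℤ)))
      (k' • (((b', 0)) : ((Fin 2 → ℤ) × (Fin 2 → ℤ)) × (Fin 2 → ℤ))) = k * k' * (hyperbolicForm.prod hyperbolicForm) b b' := by
  simp only [map_smul, LinearMap.smul_apply, smul_eq_mul, prod_hyperbolic_inl_inl]
  ring

/-- **`A_w = t(f,w)` is a word in the eight letters** for every `w ∈ L₁` with `(w,w) = 2q`: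
`t(f,w) = t(f,w₀e₁)·t(f,w₁f₁)·t(f,w₂e₂)·t(f,w₃f₂)` by (t3) (`E(f,a,q)E(f,b,q′) = E(f,a+b,q+q′+(a,b))`), each factor a power of a
letter. [cite: GritsenkoHulekSankaran2009, §3.1 (t3) and §3.3 (SO) ("E_U(L₁) = ⟨t(c,a) | a ∈ L₁, c = e or f⟩")] -/
theorem isWordIn_eightTransvections_transvectionAEquiv (w : (Fin 2 → ℤ) × (Fin 2 → ℤ)) (q : ℤ)
    (hw : (hyperbolicForm.prod hyperbolicForm) w w = q + q) :
    IsWordIn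
      {transvectionAEquiv (isSymm_hyperbolicForm.prod isSymm_hyperbolicForm) (Pi.single 0 1, 0) 0 hyperbolic_prod_hyperbolic_e₁,
        transvectionAEquiv (isSymm_hyperbolicForm.prod isSymm_hyperbolicForm) (Pi.single 1 1, 0) 0 hyperbolic_prod_hyperbolic_f₁,
        transvectionAEquiv (isSymm_hyperbolicForm.prod isSymm_hyperbolicForm) (0, Pi.single 0 1) 0 hyperbolic_prod_hyperbolic_e₂,
        transvectionAEquiv (isSymm_hyperbolicForm.prod isSymm_hyperbolicForm) (0, Pi.single 1 1) 0 hyperbolic_prod_hyperbolic_f₂,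
        transvectionA'Equiv (isSymm_hyperbolicForm.prod isSymm_hyperbolicForm) (Pi.single 0 1, 0) 0 hyperbolic_prod_hyperbolic_e₁,
        transvectionA'Equiv (isSymm_hyperbolicForm.prod isSymm_hyperbolicForm) (Pi.single 1 1, 0) 0 hyperbolic_prod_hyperbolic_f₁,
        transvectionA'Equiv (isSymm_hyperbolicForm.prod isSymm_hyperbolicForm) (0, Pi.single 0 1) 0 hyperbolic_prod_hyperbolic_e₂,
        transvectionA'Equiv (isSymm_hyperbolicForm.prod isSymm_hyperbolicForm) (0, Pi.single 1 1) 0 hyperbolic_prod_hyperbolic_f₂}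
      (transvectionAEquiv (isSymm_hyperbolicForm.prod isSymm_hyperbolicForm) w q hw) := by
  have hQ : (hyperbolicForm.prod hyperbolicForm).IsSymm := isSymm_hyperbolicForm.prod isSymm_hyperbolicForm
  have hB : ((hyperbolicForm.prod hyperbolicForm).prod hyperbolicForm).IsSymm := hQ.prod isSymm_hyperbolicForm
  have hq := eq_of_hyperbolic_prod_hyperbolic_apply_self hw
  -- the four factors
  obtain ⟨h0y, -, h00⟩ := threeU_smul_inl_ortho (w.1 0) (Pi.single 0 1, 0) hyperbolic_prod_hyperbolic_e₁
  obtain ⟨h1y, -, h11⟩ := threeU_smul_inl_ortho (w.1 1) (Pi.single 1 1, 0) hyperbolic_prod_hyperbolic_f₁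
  obtain ⟨h2y, -, h22⟩ := threeU_smul_inl_ortho (w.2 0) (0, Pi.single 0 1) hyperbolic_prod_hyperbolic_e₂
  obtain ⟨h3y, -, h33⟩ := threeU_smul_inl_ortho (w.2 1) (0, Pi.single 1 1) hyperbolic_prod_hyperbolic_f₂
  have W0 := isWordIn_eightTransvections_transvectionA_zsmul (Pi.single 0 1, 0) hyperbolic_prod_hyperbolic_e₁
    (Or.inl rfl) (w.1 0) h0y h00
  have W1 := isWordIn_eightTransvections_transvectionA_zsmul (Pi.single 1 1, 0) hyperbolic_prod_hyperbolic_f₁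
    (Or.inr (Or.inl rfl)) (w.1 1) h1y h11
  have W2 := isWordIn_eightTransvections_transvectionA_zsmul (0, Pi.single 0 1) hyperbolic_prod_hyperbolic_e₂
    (Or.inr (Or.inr (Or.inl rfl))) (w.2 0) h2y h22
  have W3 := isWordIn_eightTransvections_transvectionA_zsmul (0, Pi.single 1 1) hyperbolic_prod_hyperbolic_f₂
    (Or.inr (Or.inr (Or.inr (Or.inl rfl)))) (w.2 1) h3y h33
  -- (t3) three times
  have h23y : ((hyperbolicForm.prod hyperbolicForm).prod hyperbolicForm) hypY
      ((w.2 0) • ((((0, Pi.single 0 1), 0)) : ((Fin 2 → ℤ) × (Fin 2 → ℤ)) × (Fin 2 → ℤ)) +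
        (w.2 1) • (((0, Pi.single 1 1), 0))) = 0 := by rw [map_add, h2y, h3y, add_zero]
  have h123y : ((hyperbolicForm.prod hyperbolicForm).prod hyperbolicForm) hypY
      ((w.1 1) • ((((Pi.single 1 1, 0), 0)) : ((Fin 2 → ℤ) × (Fin 2 → ℤ)) × (Fin 2 → ℤ)) +
        ((w.2 0) • (((0, Pi.single 0 1), 0)) + (w.2 1) • (((0, Pi.single 1 1), 0)))) = 0 := by
    rw [map_add, h1y, h23y, add_zero]
  have comp :
      ((hyperbolicForm.prod hyperbolicForm).prod hyperbolicForm).eichlerTransvection hypY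
          ((w.1 0) • ((((Pi.single 0 1, 0), 0)) : ((Fin 2 → ℤ) × (Fin 2 → ℤ)) × (Fin 2 → ℤ))) 0 ∘ₗ
        (((hyperbolicForm.prod hyperbolicForm).prod hyperbolicForm).eichlerTransvection hypY
            ((w.1 1) • ((((Pi.single 1 1, 0), 0)) : ((Fin 2 → ℤ) × (Fin 2 → ℤ)) × (Fin 2 → ℤ))) 0 ∘ₗ
          (((hyperbolicForm.prod hyperbolicForm).prod hyperbolicForm).eichlerTransvection hypY
              ((w.2 0) • ((((0, Pi.single 0 1), 0)) : ((Fin 2 → ℤ) × (Fin 2 → ℤ)) × (Fin 2 → ℤ))) 0 ∘ₗ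
            ((hyperbolicForm.prod hyperbolicForm).prod hyperbolicForm).eichlerTransvection hypY
              ((w.2 1) • ((((0, Pi.single 1 1), 0)) : ((Fin 2 → ℤ) × (Fin 2 → ℤ)) × (Fin 2 → ℤ))) 0)) =
      ((hyperbolicForm.prod hyperbolicForm).prod hyperbolicForm).eichlerTransvection hypY ((w, 0)) q := by
    rw [LinearMap.BilinForm.eichlerTransvection_comp _ hB prod_prod_hyperbolic_hypY_hypY h2y h3y,
      LinearMap.BilinForm.eichlerTransvection_comp _ hB prod_prod_hyperbolic_hypY_hypY h1y h23y,
      LinearMap.BilinForm.eichlerTransvection_comp _ hB prod_prod_hyperbolic_hypY_hypY h0y h123y, ← inl_eq_sum_smul_basis w]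
    have hp : (0 : ℤ) + (0 + (0 + 0 + ((hyperbolicForm.prod hyperbolicForm).prod hyperbolicForm)
          ((w.2 0) • ((((0, Pi.single 0 1), 0)) : ((Fin 2 → ℤ) × (Fin 2 → ℤ)) × (Fin 2 → ℤ)))
          ((w.2 1) • (((0, Pi.single 1 1), 0)))) +
        ((hyperbolicForm.prod hyperbolicForm).prod hyperbolicForm)
          ((w.1 1) • ((((Pi.single 1 1, 0), 0)) : ((Fin 2 → ℤ) × (Fin 2 → ℤ)) × (Fin 2 → ℤ)))
          ((w.2 0) • (((0, Pi.single 0 1), 0)) + (w.2 1) • (((0, Pi.single 1 1), 0)))) +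
        ((hyperbolicForm.prod hyperbolicForm).prod hyperbolicForm)
          ((w.1 0) • ((((Pi.single 0 1, 0), 0)) : ((Fin 2 → ℤ) × (Fin 2 → ℤ)) × (Fin 2 → ℤ)))
          ((w.1 1) • (((Pi.single 1 1, 0), 0)) + ((w.2 0) • (((0, Pi.single 0 1), 0)) + (w.2 1) • (((0, Pi.single 1 1), 0)))) =
        q := by
      simp only [map_add, threeU_smul_inl_smul_inl, hyperbolic_prod_hyperbolic_apply, hq]
      simp
      ring
    rw [hp]
  refine (((W3.trans W2).trans W1).trans W0).congr fun v ↦ ?_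
  rw [LinearMap.BilinForm.IsometryEquiv.trans_apply, LinearMap.BilinForm.IsometryEquiv.trans_apply,
    LinearMap.BilinForm.IsometryEquiv.trans_apply, LinearMap.BilinForm.IsometryEquiv.eichlerTransvection_apply,
    LinearMap.BilinForm.IsometryEquiv.eichlerTransvection_apply, LinearMap.BilinForm.IsometryEquiv.eichlerTransvection_apply,
    LinearMap.BilinForm.IsometryEquiv.eichlerTransvection_apply, transvectionAEquiv_apply, transvectionA,
    ← comp, LinearMap.comp_apply, LinearMap.comp_apply, LinearMap.comp_apply]

/-- **`A'_w = t(e,w)` is a word in the eight letters** (`w ∈ L₁`, `(w,w) = 2q`). [cite: GritsenkoHulekSankaran2009, §3.1 (t3) and §3.3 (SO)] -/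
theorem isWordIn_eightTransvections_transvectionA'Equiv (w : (Fin 2 → ℤ) × (Fin 2 → ℤ)) (q : ℤ)
    (hw : (hyperbolicForm.prod hyperbolicForm) w w = q + q) :
    IsWordIn
      {transvectionAEquiv (isSymm_hyperbolicForm.prod isSymm_hyperbolicForm) (Pi.single 0 1, 0) 0 hyperbolic_prod_hyperbolic_e₁,
        transvectionAEquiv (isSymm_hyperbolicForm.prod isSymm_hyperbolicForm) (Pi.single 1 1, 0) 0 hyperbolic_prod_hyperbolic_f₁,
        transvectionAEquiv (isSymm_hyperbolicForm.prod isSymm_hyperbolicForm) (0, Pi.single 0 1) 0 hyperbolic_prod_hyperbolic_e₂,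
        transvectionAEquiv (isSymm_hyperbolicForm.prod isSymm_hyperbolicForm) (0, Pi.single 1 1) 0 hyperbolic_prod_hyperbolic_f₂,
        transvectionA'Equiv (isSymm_hyperbolicForm.prod isSymm_hyperbolicForm) (Pi.single 0 1, 0) 0 hyperbolic_prod_hyperbolic_e₁,
        transvectionA'Equiv (isSymm_hyperbolicForm.prod isSymm_hyperbolicForm) (Pi.single 1 1, 0) 0 hyperbolic_prod_hyperbolic_f₁,
        transvectionA'Equiv (isSymm_hyperbolicForm.prod isSymm_hyperbolicForm) (0, Pi.single 0 1) 0 hyperbolic_prod_hyperbolic_e₂,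
        transvectionA'Equiv (isSymm_hyperbolicForm.prod isSymm_hyperbolicForm) (0, Pi.single 1 1) 0 hyperbolic_prod_hyperbolic_f₂}
      (transvectionA'Equiv (isSymm_hyperbolicForm.prod isSymm_hyperbolicForm) w q hw) := by
  have hQ : (hyperbolicForm.prod hyperbolicForm).IsSymm := isSymm_hyperbolicForm.prod isSymm_hyperbolicForm
  have hB : ((hyperbolicForm.prod hyperbolicForm).prod hyperbolicForm).IsSymm := hQ.prod isSymm_hyperbolicForm
  have hq := eq_of_hyperbolic_prod_hyperbolic_apply_self hw
  obtain ⟨-, h0x, h00⟩ := threeU_smul_inl_ortho (w.1 0) (Pi.single 0 1, 0) hyperbolic_prod_hyperbolic_e₁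
  obtain ⟨-, h1x, h11⟩ := threeU_smul_inl_ortho (w.1 1) (Pi.single 1 1, 0) hyperbolic_prod_hyperbolic_f₁
  obtain ⟨-, h2x, h22⟩ := threeU_smul_inl_ortho (w.2 0) (0, Pi.single 0 1) hyperbolic_prod_hyperbolic_e₂
  obtain ⟨-, h3x, h33⟩ := threeU_smul_inl_ortho (w.2 1) (0, Pi.single 1 1) hyperbolic_prod_hyperbolic_f₂
  have W0 := isWordIn_eightTransvections_transvectionA'_zsmul (Pi.single 0 1, 0) hyperbolic_prod_hyperbolic_e₁
    (Or.inr (Or.inr (Or.inr (Or.inr (Or.inl rfl))))) (w.1 0) h0x h00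
  have W1 := isWordIn_eightTransvections_transvectionA'_zsmul (Pi.single 1 1, 0) hyperbolic_prod_hyperbolic_f₁
    (Or.inr (Or.inr (Or.inr (Or.inr (Or.inr (Or.inl rfl)))))) (w.1 1) h1x h11
  have W2 := isWordIn_eightTransvections_transvectionA'_zsmul (0, Pi.single 0 1) hyperbolic_prod_hyperbolic_e₂
    (Or.inr (Or.inr (Or.inr (Or.inr (Or.inr (Or.inr (Or.inl rfl))))))) (w.2 0) h2x h22
  have W3 := isWordIn_eightTransvections_transvectionA'_zsmul (0, Pi.single 1 1) hyperbolic_prod_hyperbolic_f₂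
    (Or.inr (Or.inr (Or.inr (Or.inr (Or.inr (Or.inr (Or.inr rfl))))))) (w.2 1) h3x h33
  have h23x : ((hyperbolicForm.prod hyperbolicForm).prod hyperbolicForm) hypX
      ((w.2 0) • ((((0, Pi.single 0 1), 0)) : ((Fin 2 → ℤ) × (Fin 2 → ℤ)) × (Fin 2 → ℤ)) +
        (w.2 1) • (((0, Pi.single 1 1), 0))) = 0 := by rw [map_add, h2x, h3x, add_zero]
  have h123x : ((hyperbolicForm.prod hyperbolicForm).prod hyperbolicForm) hypX
      ((w.1 1) • ((((Pi.single 1 1, 0), 0)) : ((Fin 2 → ℤ) × (Fin 2 → ℤ)) × (Fin 2 → ℤ)) +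
        ((w.2 0) • (((0, Pi.single 0 1), 0)) + (w.2 1) • (((0, Pi.single 1 1), 0)))) = 0 := by
    rw [map_add, h1x, h23x, add_zero]
  have comp :
      ((hyperbolicForm.prod hyperbolicForm).prod hyperbolicForm).eichlerTransvection hypX
          ((w.1 0) • ((((Pi.single 0 1, 0), 0)) : ((Fin 2 → ℤ) × (Fin 2 → ℤ)) × (Fin 2 → ℤ))) 0 ∘ₗ
        (((hyperbolicForm.prod hyperbolicForm).prod hyperbolicForm).eichlerTransvection hypX
            ((w.1 1) • ((((Pi.single 1 1, 0), 0)) : ((Fin 2 → ℤ) × (Fin 2 → ℤ)) × (Fin 2 → ℤ))) 0 ∘ₗ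
          (((hyperbolicForm.prod hyperbolicForm).prod hyperbolicForm).eichlerTransvection hypX
              ((w.2 0) • ((((0, Pi.single 0 1), 0)) : ((Fin 2 → ℤ) × (Fin 2 → ℤ)) × (Fin 2 → ℤ))) 0 ∘ₗ
            ((hyperbolicForm.prod hyperbolicForm).prod hyperbolicForm).eichlerTransvection hypX
              ((w.2 1) • ((((0, Pi.single 1 1), 0)) : ((Fin 2 → ℤ) × (Fin 2 → ℤ)) × (Fin 2 → ℤ))) 0)) =
      ((hyperbolicForm.prod hyperbolicForm).prod hyperbolicForm).eichlerTransvection hypX ((w, 0)) q := by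
    rw [LinearMap.BilinForm.eichlerTransvection_comp _ hB prod_prod_hyperbolic_hypX_hypX h2x h3x,
      LinearMap.BilinForm.eichlerTransvection_comp _ hB prod_prod_hyperbolic_hypX_hypX h1x h23x,
      LinearMap.BilinForm.eichlerTransvection_comp _ hB prod_prod_hyperbolic_hypX_hypX h0x h123x, ← inl_eq_sum_smul_basis w]
    have hp : (0 : ℤ) + (0 + (0 + 0 + ((hyperbolicForm.prod hyperbolicForm).prod hyperbolicForm)
          ((w.2 0) • ((((0, Pi.single 0 1), 0)) : ((Fin 2 → ℤ) × (Fin 2 → ℤ)) × (Fin 2 → ℤ)))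
          ((w.2 1) • (((0, Pi.single 1 1), 0)))) +
        ((hyperbolicForm.prod hyperbolicForm).prod hyperbolicForm)
          ((w.1 1) • ((((Pi.single 1 1, 0), 0)) : ((Fin 2 → ℤ) × (Fin 2 → ℤ)) × (Fin 2 → ℤ)))
          ((w.2 0) • (((0, Pi.single 0 1), 0)) + (w.2 1) • (((0, Pi.single 1 1), 0)))) +
        ((hyperbolicForm.prod hyperbolicForm).prod hyperbolicForm)
          ((w.1 0) • ((((Pi.single 0 1, 0), 0)) : ((Fin 2 → ℤ) × (Fin 2 → ℤ)) × (Fin 2 → ℤ)))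
          ((w.1 1) • (((Pi.single 1 1, 0), 0)) + ((w.2 0) • (((0, Pi.single 0 1), 0)) + (w.2 1) • (((0, Pi.single 1 1), 0)))) =
        q := by
      simp only [map_add, threeU_smul_inl_smul_inl, hyperbolic_prod_hyperbolic_apply, hq]
      simp
      ring
    rw [hp]
  refine (((W3.trans W2).trans W1).trans W0).congr fun v ↦ ?_
  rw [LinearMap.BilinForm.IsometryEquiv.trans_apply, LinearMap.BilinForm.IsometryEquiv.trans_apply,
    LinearMap.BilinForm.IsometryEquiv.trans_apply, LinearMap.BilinForm.IsometryEquiv.eichlerTransvection_apply,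
    LinearMap.BilinForm.IsometryEquiv.eichlerTransvection_apply, LinearMap.BilinForm.IsometryEquiv.eichlerTransvection_apply,
    LinearMap.BilinForm.IsometryEquiv.eichlerTransvection_apply, transvectionA'Equiv_apply, transvectionA',
    ← comp, LinearMap.comp_apply, LinearMap.comp_apply, LinearMap.comp_apply]

end Letters

/-! ### §2 Admissible letters and words are words in the eight letters -/

section AdmissibleWords

/-- A vector of `3U` orthogonal to the outer pair lies in `L₁ ⊕ 0`. [cite: GritsenkoHulekSankaran2009, §3.3 ("L = U ⊕ L₁")] -/
theorem eq_inl_of_ortho_hypX_hypY {a : ((Fin 2 → ℤ) × (Fin 2 → ℤ)) × (Fin 2 → ℤ)}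
    (hx : ((hyperbolicForm.prod hyperbolicForm).prod hyperbolicForm) hypX a = 0)
    (hy : ((hyperbolicForm.prod hyperbolicForm).prod hyperbolicForm) hypY a = 0) : a = (a.1, 0) := by
  have hB : ((hyperbolicForm.prod hyperbolicForm).prod hyperbolicForm).IsSymm :=
    (isSymm_hyperbolicForm.prod isSymm_hyperbolicForm).prod isSymm_hyperbolicForm
  rw [hB.eq, prod_hyperbolic_apply_hypX] at hx
  rw [hB.eq, prod_hyperbolic_apply_hypY] at hy
  refine Prod.ext rfl (funext fun i ↦ ?_)
  fin_cases i
  · exact hy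
  · exact hx

/-- **Every admissible letter `E(y,a,q)`, `E(x,a,q)` of `3U` is a word in the eight letters** (it is `A_{a₁}` resp. `A'_{a₁}` for
the `L₁`-component `a₁` of `a`). [cite: GritsenkoHulekSankaran2009, §3.3 (SO)] -/
theorem isWordIn_eightTransvections_toIsometryEquiv (g : UGen (((Fin 2 → ℤ) × (Fin 2 → ℤ)) × (Fin 2 → ℤ)))
    (hg : g.IsAdmissible ((hyperbolicForm.prod hyperbolicForm).prod hyperbolicForm) hypX hypY) :
    IsWordIn
      {transvectionAEquiv (isSymm_hyperbolicForm.prod isSymm_hyperbolicForm) (Pi.single 0 1, 0) 0 hyperbolic_prod_hyperbolic_e₁,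
        transvectionAEquiv (isSymm_hyperbolicForm.prod isSymm_hyperbolicForm) (Pi.single 1 1, 0) 0 hyperbolic_prod_hyperbolic_f₁,
        transvectionAEquiv (isSymm_hyperbolicForm.prod isSymm_hyperbolicForm) (0, Pi.single 0 1) 0 hyperbolic_prod_hyperbolic_e₂,
        transvectionAEquiv (isSymm_hyperbolicForm.prod isSymm_hyperbolicForm) (0, Pi.single 1 1) 0 hyperbolic_prod_hyperbolic_f₂,
        transvectionA'Equiv (isSymm_hyperbolicForm.prod isSymm_hyperbolicForm) (Pi.single 0 1, 0) 0 hyperbolic_prod_hyperbolic_e₁,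
        transvectionA'Equiv (isSymm_hyperbolicForm.prod isSymm_hyperbolicForm) (Pi.single 1 1, 0) 0 hyperbolic_prod_hyperbolic_f₁,
        transvectionA'Equiv (isSymm_hyperbolicForm.prod isSymm_hyperbolicForm) (0, Pi.single 0 1) 0 hyperbolic_prod_hyperbolic_e₂,
        transvectionA'Equiv (isSymm_hyperbolicForm.prod isSymm_hyperbolicForm) (0, Pi.single 1 1) 0 hyperbolic_prod_hyperbolic_f₂}
      (UGen.toIsometryEquiv ((isSymm_hyperbolicForm.prod isSymm_hyperbolicForm).prod isSymm_hyperbolicForm)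
        prod_prod_hyperbolic_hypX_hypX prod_prod_hyperbolic_hypY_hypY g hg) := by
  cases g with
  | atY a q =>
    obtain ⟨hxa, hya, hq⟩ := hg
    have ha := eq_inl_of_ortho_hypX_hypY hxa hya
    have hq' : (hyperbolicForm.prod hyperbolicForm) a.1 a.1 = q + q := by rw [← prod_hyperbolic_inl_inl, ← ha, hq]
    refine (isWordIn_eightTransvections_transvectionAEquiv a.1 q hq').congr fun v ↦ ?_
    rw [transvectionAEquiv_apply, transvectionA, UGen.toIsometryEquiv_apply, ← ha]
    rfl
  | atX a q =>
    obtain ⟨hxa, hya, hq⟩ := hg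
    have ha := eq_inl_of_ortho_hypX_hypY hxa hya
    have hq' : (hyperbolicForm.prod hyperbolicForm) a.1 a.1 = q + q := by rw [← prod_hyperbolic_inl_inl, ← ha, hq]
    refine (isWordIn_eightTransvections_transvectionA'Equiv a.1 q hq').congr fun v ↦ ?_
    rw [transvectionA'Equiv_apply, transvectionA', UGen.toIsometryEquiv_apply, ← ha]
    rfl

/-- **Every admissible word of `3U` (an element of `E_U(L₁)`) is a word in the eight letters.**
[cite: GritsenkoHulekSankaran2009, §3.3 (SO) ("E_U(L₁) = ⟨t(c,a) | a ∈ L₁, c = e or f⟩")] -/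
theorem isWordIn_eightTransvections_evalEquiv (l : List (UGen (((Fin 2 → ℤ) × (Fin 2 → ℤ)) × (Fin 2 → ℤ))))
    (hl : ∀ g ∈ l, g.IsAdmissible ((hyperbolicForm.prod hyperbolicForm).prod hyperbolicForm) hypX hypY) :
    IsWordIn
      {transvectionAEquiv (isSymm_hyperbolicForm.prod isSymm_hyperbolicForm) (Pi.single 0 1, 0) 0 hyperbolic_prod_hyperbolic_e₁,
        transvectionAEquiv (isSymm_hyperbolicForm.prod isSymm_hyperbolicForm) (Pi.single 1 1, 0) 0 hyperbolic_prod_hyperbolic_f₁,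
        transvectionAEquiv (isSymm_hyperbolicForm.prod isSymm_hyperbolicForm) (0, Pi.single 0 1) 0 hyperbolic_prod_hyperbolic_e₂,
        transvectionAEquiv (isSymm_hyperbolicForm.prod isSymm_hyperbolicForm) (0, Pi.single 1 1) 0 hyperbolic_prod_hyperbolic_f₂,
        transvectionA'Equiv (isSymm_hyperbolicForm.prod isSymm_hyperbolicForm) (Pi.single 0 1, 0) 0 hyperbolic_prod_hyperbolic_e₁,
        transvectionA'Equiv (isSymm_hyperbolicForm.prod isSymm_hyperbolicForm) (Pi.single 1 1, 0) 0 hyperbolic_prod_hyperbolic_f₁,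
        transvectionA'Equiv (isSymm_hyperbolicForm.prod isSymm_hyperbolicForm) (0, Pi.single 0 1) 0 hyperbolic_prod_hyperbolic_e₂,
        transvectionA'Equiv (isSymm_hyperbolicForm.prod isSymm_hyperbolicForm) (0, Pi.single 1 1) 0 hyperbolic_prod_hyperbolic_f₂}
      (UGen.evalEquiv ((isSymm_hyperbolicForm.prod isSymm_hyperbolicForm).prod isSymm_hyperbolicForm)
        prod_prod_hyperbolic_hypX_hypX prod_prod_hyperbolic_hypY_hypY l hl) := by
  induction l with
  | nil => exact IsWordIn.refl
  | cons g l ih =>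
    exact (ih fun g' hg' ↦ hl g' (List.mem_cons_of_mem g hg')).trans
      (isWordIn_eightTransvections_toIsometryEquiv g (hl g List.mem_cons_self))

end AdmissibleWords

/-! ### §3 `SO⁺(3U)`, `O⁺(3U)`, `O(3U)` by eight, nine, ten generators -/

section Generation

/-- The eight letters are Eichler transvections, so they lie in `S̃O⁺(3U)`. [cite: GritsenkoHulekSankaran2009, §3.1 (8) ("t(e,a) ∈ S̃O⁺(L)")] -/
theorem isOrientationPreserving_and_det_eq_one_of_mem_eightTransvections
    {s : ((hyperbolicForm.prod hyperbolicForm).prod hyperbolicForm).IsometryEquiv ((hyperbolicForm.prod hyperbolicForm).prod hyperbolicForm)}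
    (hs : s ∈ ({transvectionAEquiv (isSymm_hyperbolicForm.prod isSymm_hyperbolicForm) (Pi.single 0 1, 0) 0 hyperbolic_prod_hyperbolic_e₁,
        transvectionAEquiv (isSymm_hyperbolicForm.prod isSymm_hyperbolicForm) (Pi.single 1 1, 0) 0 hyperbolic_prod_hyperbolic_f₁,
        transvectionAEquiv (isSymm_hyperbolicForm.prod isSymm_hyperbolicForm) (0, Pi.single 0 1) 0 hyperbolic_prod_hyperbolic_e₂,
        transvectionAEquiv (isSymm_hyperbolicForm.prod isSymm_hyperbolicForm) (0, Pi.single 1 1) 0 hyperbolic_prod_hyperbolic_f₂,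
        transvectionA'Equiv (isSymm_hyperbolicForm.prod isSymm_hyperbolicForm) (Pi.single 0 1, 0) 0 hyperbolic_prod_hyperbolic_e₁,
        transvectionA'Equiv (isSymm_hyperbolicForm.prod isSymm_hyperbolicForm) (Pi.single 1 1, 0) 0 hyperbolic_prod_hyperbolic_f₁,
        transvectionA'Equiv (isSymm_hyperbolicForm.prod isSymm_hyperbolicForm) (0, Pi.single 0 1) 0 hyperbolic_prod_hyperbolic_e₂,
        transvectionA'Equiv (isSymm_hyperbolicForm.prod isSymm_hyperbolicForm) (0, Pi.single 1 1) 0 hyperbolic_prod_hyperbolic_f₂} :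
        Set (((hyperbolicForm.prod hyperbolicForm).prod hyperbolicForm).IsometryEquiv
          ((hyperbolicForm.prod hyperbolicForm).prod hyperbolicForm)))) :
    s.IsOrientationPreserving ∧ LinearMap.det (s : ((Fin 2 → ℤ) × (Fin 2 → ℤ)) × (Fin 2 → ℤ) →ₗ[ℤ]
      ((Fin 2 → ℤ) × (Fin 2 → ℤ)) × (Fin 2 → ℤ)) = 1 := by
  have hQ : (hyperbolicForm.prod hyperbolicForm).IsSymm := isSymm_hyperbolicForm.prod isSymm_hyperbolicForm
  rcases hs with rfl | rfl | rfl | rfl | rfl | rfl | rfl | rfl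
  · exact (transvectionAEquiv_mem_stableSpecialOrthogonal hQ nondegenerate_threeU _ 0 _).2
  · exact (transvectionAEquiv_mem_stableSpecialOrthogonal hQ nondegenerate_threeU _ 0 _).2
  · exact (transvectionAEquiv_mem_stableSpecialOrthogonal hQ nondegenerate_threeU _ 0 _).2
  · exact (transvectionAEquiv_mem_stableSpecialOrthogonal hQ nondegenerate_threeU _ 0 _).2
  · exact (transvectionA'Equiv_mem_stableSpecialOrthogonal hQ nondegenerate_threeU _ 0 _).2
  · exact (transvectionA'Equiv_mem_stableSpecialOrthogonal hQ nondegenerate_threeU _ 0 _).2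
  · exact (transvectionA'Equiv_mem_stableSpecialOrthogonal hQ nondegenerate_threeU _ 0 _).2
  · exact (transvectionA'Equiv_mem_stableSpecialOrthogonal hQ nondegenerate_threeU _ 0 _).2

/-- **`SO⁺(U ⊕ U ⊕ U) = ⟨t(f,e₁), t(f,f₁), t(f,e₂), t(f,f₂), t(e,e₁), t(e,f₁), t(e,e₂), t(e,f₂)⟩`**: an isometry of `(H ⊕ H) ⊕ H`
is a word in the eight letters iff it lies in `O⁺` with `det = 1` — (SO) "`S̃O⁺(L) = E_U(L₁) = ⟨t(c,a) | a ∈ L₁, c = e or f⟩`" for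
`L = 3U`, with `a` restricted to the basis `e₁, f₁, e₂, f₂` by (t3). [cite: GritsenkoHulekSankaran2009, §3.3 (SO) and §3.1 (t3), (8)] -/
theorem isWordIn_eightTransvections_iff
    (φ : ((hyperbolicForm.prod hyperbolicForm).prod hyperbolicForm).IsometryEquiv ((hyperbolicForm.prod hyperbolicForm).prod hyperbolicForm)) :
    IsWordIn
      {transvectionAEquiv (isSymm_hyperbolicForm.prod isSymm_hyperbolicForm) (Pi.single 0 1, 0) 0 hyperbolic_prod_hyperbolic_e₁,
        transvectionAEquiv (isSymm_hyperbolicForm.prod isSymm_hyperbolicForm) (Pi.single 1 1, 0) 0 hyperbolic_prod_hyperbolic_f₁,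
        transvectionAEquiv (isSymm_hyperbolicForm.prod isSymm_hyperbolicForm) (0, Pi.single 0 1) 0 hyperbolic_prod_hyperbolic_e₂,
        transvectionAEquiv (isSymm_hyperbolicForm.prod isSymm_hyperbolicForm) (0, Pi.single 1 1) 0 hyperbolic_prod_hyperbolic_f₂,
        transvectionA'Equiv (isSymm_hyperbolicForm.prod isSymm_hyperbolicForm) (Pi.single 0 1, 0) 0 hyperbolic_prod_hyperbolic_e₁,
        transvectionA'Equiv (isSymm_hyperbolicForm.prod isSymm_hyperbolicForm) (Pi.single 1 1, 0) 0 hyperbolic_prod_hyperbolic_f₁,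
        transvectionA'Equiv (isSymm_hyperbolicForm.prod isSymm_hyperbolicForm) (0, Pi.single 0 1) 0 hyperbolic_prod_hyperbolic_e₂,
        transvectionA'Equiv (isSymm_hyperbolicForm.prod isSymm_hyperbolicForm) (0, Pi.single 1 1) 0 hyperbolic_prod_hyperbolic_f₂} φ ↔
      φ.IsOrientationPreserving ∧ LinearMap.det (φ : ((Fin 2 → ℤ) × (Fin 2 → ℤ)) × (Fin 2 → ℤ) →ₗ[ℤ]
        ((Fin 2 → ℤ) × (Fin 2 → ℤ)) × (Fin 2 → ℤ)) = 1 := by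
  have hB : ((hyperbolicForm.prod hyperbolicForm).prod hyperbolicForm).IsSymm :=
    (isSymm_hyperbolicForm.prod isSymm_hyperbolicForm).prod isSymm_hyperbolicForm
  refine ⟨fun h ↦ ?_, fun h ↦ ?_⟩
  · exact ⟨h.isOrientationPreserving hB nondegenerate_threeU fun s hs ↦
        (isOrientationPreserving_and_det_eq_one_of_mem_eightTransvections hs).1,
      h.det_eq_one fun s hs ↦ (isOrientationPreserving_and_det_eq_one_of_mem_eightTransvections hs).2⟩
  · obtain ⟨L, hL, rfl⟩ := (isOrientationPreserving_and_det_eq_one_iff_exists_uGens_threeU φ).1 h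
    exact isWordIn_eightTransvections_evalEquiv L hL

/-- **`O⁺(U ⊕ U ⊕ U) = ⟨the eight transvections, σ⟩`** with `σ = 1 ⊕ σ_H` the `(−2)`-reflection `σ_{e−f}` of the outer plane:
an isometry of `(H ⊕ H) ⊕ H` is a word in these nine iff it lies in `O⁺` ("`Õ⁺(L) = ⟨S̃O⁺(L), σ_{e−f}⟩`" for `L = 3U`).
[cite: GritsenkoHulekSankaran2009, §4 ("Õ⁺(L) = ⟨S̃O⁺(L), σ_{e−f}⟩") and §3.3 (SO)] -/
theorem isWordIn_nineGenerators_iff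
    (φ : ((hyperbolicForm.prod hyperbolicForm).prod hyperbolicForm).IsometryEquiv ((hyperbolicForm.prod hyperbolicForm).prod hyperbolicForm)) :
    IsWordIn
      (insert (LinearMap.BilinForm.IsometryEquiv.prodCongr
          (LinearMap.BilinForm.IsometryEquiv.refl (hyperbolicForm.prod hyperbolicForm)) hyperbolicSwap)
      {transvectionAEquiv (isSymm_hyperbolicForm.prod isSymm_hyperbolicForm) (Pi.single 0 1, 0) 0 hyperbolic_prod_hyperbolic_e₁,
        transvectionAEquiv (isSymm_hyperbolicForm.prod isSymm_hyperbolicForm) (Pi.single 1 1, 0) 0 hyperbolic_prod_hyperbolic_f₁,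
        transvectionAEquiv (isSymm_hyperbolicForm.prod isSymm_hyperbolicForm) (0, Pi.single 0 1) 0 hyperbolic_prod_hyperbolic_e₂,
        transvectionAEquiv (isSymm_hyperbolicForm.prod isSymm_hyperbolicForm) (0, Pi.single 1 1) 0 hyperbolic_prod_hyperbolic_f₂,
        transvectionA'Equiv (isSymm_hyperbolicForm.prod isSymm_hyperbolicForm) (Pi.single 0 1, 0) 0 hyperbolic_prod_hyperbolic_e₁,
        transvectionA'Equiv (isSymm_hyperbolicForm.prod isSymm_hyperbolicForm) (Pi.single 1 1, 0) 0 hyperbolic_prod_hyperbolic_f₁,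
        transvectionA'Equiv (isSymm_hyperbolicForm.prod isSymm_hyperbolicForm) (0, Pi.single 0 1) 0 hyperbolic_prod_hyperbolic_e₂,
        transvectionA'Equiv (isSymm_hyperbolicForm.prod isSymm_hyperbolicForm) (0, Pi.single 1 1) 0 hyperbolic_prod_hyperbolic_f₂})
      φ ↔ φ.IsOrientationPreserving := by
  have hQ : (hyperbolicForm.prod hyperbolicForm).IsSymm := isSymm_hyperbolicForm.prod isSymm_hyperbolicForm
  have hB : ((hyperbolicForm.prod hyperbolicForm).prod hyperbolicForm).IsSymm := hQ.prod isSymm_hyperbolicForm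
  have hσ : (LinearMap.BilinForm.IsometryEquiv.prodCongr
      (LinearMap.BilinForm.IsometryEquiv.refl (hyperbolicForm.prod hyperbolicForm)) hyperbolicSwap :
      ((hyperbolicForm.prod hyperbolicForm).prod hyperbolicForm).IsometryEquiv _).IsOrientationPreserving := by
    rw [LinearMap.BilinForm.IsometryEquiv.isOrientationPreserving_refl_prodCongr_iff hQ nondegenerate_hyperbolicForm_prod_hyperbolicForm
      isSymm_hyperbolicForm isUnimodular_hyperbolicForm_holds.nondegenerate]
    exact isOrientationPreserving_hyperbolicSwap
  refine ⟨fun h ↦ h.isOrientationPreserving hB nondegenerate_threeU fun s hs ↦ ?_, fun h₁ ↦ ?_⟩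
  · rcases hs with rfl | hs
    · exact hσ
    · exact (isOrientationPreserving_and_det_eq_one_of_mem_eightTransvections hs).1
  · rcases LinearMap.BilinForm.IsometryEquiv.det_eq_one_or_eq_neg_one φ with hd | hd
    · exact ((isWordIn_eightTransvections_iff φ).2 ⟨h₁, hd⟩).bind fun s hs ↦ IsWordIn.of_mem (Set.mem_insert_of_mem _ hs)
    · -- `φσ ∈ SO⁺`, and `φ = (φσ)σ`
      obtain ⟨hP, hdet⟩ := isOrientationPreserving_and_det_trans_refl_prodCongr_threeU φ hyperbolicSwap
      have hw := (isWordIn_eightTransvections_iff _).2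
        ⟨hP.2 (iff_of_true isOrientationPreserving_hyperbolicSwap h₁), by rw [hdet, det_hyperbolicSwap, hd]; norm_num⟩
      refine ((hw.bind fun s hs ↦ IsWordIn.of_mem (Set.mem_insert_of_mem _ hs)).trans
        (IsWordIn.of_mem (Set.mem_insert _ _))).congr fun v ↦ ?_
      rw [LinearMap.BilinForm.IsometryEquiv.trans_apply, LinearMap.BilinForm.IsometryEquiv.trans_apply]
      refine Prod.ext rfl ?_
      change hyperbolicSwap (hyperbolicSwap (φ v).2) = (φ v).2
      rw [hyperbolicSwap_apply, hyperbolicSwap_apply]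
      ext i
      fin_cases i <;> rfl

/-- **`O(U ⊕ U ⊕ U) = ⟨the eight transvections, σ, ν⟩`** with `ν = 1 ⊕ (−1_H)` (`ν ∉ O⁺`): EVERY isometry of `(H ⊕ H) ⊕ H`
is a word in these ten (`O = O⁺ ⊔ O⁺·ν`). [cite: GritsenkoHulekSankaran2009, §4 and Thm. 1.7 (Õ⁺ of index 2 in its det-extension)] [cite: GritsenkoHulekSankaran2007HM, §4 Lemma 4.2 ("[O : O⁺] = 2")] -/
theorem isWordIn_tenGenerators
    (φ : ((hyperbolicForm.prod hyperbolicForm).prod hyperbolicForm).IsometryEquiv ((hyperbolicForm.prod hyperbolicForm).prod hyperbolicForm)) :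
    IsWordIn
      (insert (LinearMap.BilinForm.IsometryEquiv.prodCongr
          (LinearMap.BilinForm.IsometryEquiv.refl (hyperbolicForm.prod hyperbolicForm)) (LinearMap.BilinForm.IsometryEquiv.neg hyperbolicForm))
      (insert (LinearMap.BilinForm.IsometryEquiv.prodCongr
          (LinearMap.BilinForm.IsometryEquiv.refl (hyperbolicForm.prod hyperbolicForm)) hyperbolicSwap)
      {transvectionAEquiv (isSymm_hyperbolicForm.prod isSymm_hyperbolicForm) (Pi.single 0 1, 0) 0 hyperbolic_prod_hyperbolic_e₁,
        transvectionAEquiv (isSymm_hyperbolicForm.prod isSymm_hyperbolicForm) (Pi.single 1 1, 0) 0 hyperbolic_prod_hyperbolic_f₁,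
        transvectionAEquiv (isSymm_hyperbolicForm.prod isSymm_hyperbolicForm) (0, Pi.single 0 1) 0 hyperbolic_prod_hyperbolic_e₂,
        transvectionAEquiv (isSymm_hyperbolicForm.prod isSymm_hyperbolicForm) (0, Pi.single 1 1) 0 hyperbolic_prod_hyperbolic_f₂,
        transvectionA'Equiv (isSymm_hyperbolicForm.prod isSymm_hyperbolicForm) (Pi.single 0 1, 0) 0 hyperbolic_prod_hyperbolic_e₁,
        transvectionA'Equiv (isSymm_hyperbolicForm.prod isSymm_hyperbolicForm) (Pi.single 1 1, 0) 0 hyperbolic_prod_hyperbolic_f₁,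
        transvectionA'Equiv (isSymm_hyperbolicForm.prod isSymm_hyperbolicForm) (0, Pi.single 0 1) 0 hyperbolic_prod_hyperbolic_e₂,
        transvectionA'Equiv (isSymm_hyperbolicForm.prod isSymm_hyperbolicForm) (0, Pi.single 1 1) 0 hyperbolic_prod_hyperbolic_f₂}))
      φ := by
  by_cases h₁ : φ.IsOrientationPreserving
  · exact ((isWordIn_nineGenerators_iff φ).2 h₁).bind fun s hs ↦ IsWordIn.of_mem (Set.mem_insert_of_mem _ hs)
  · -- `φν ∈ O⁺`, and `φ = (φν)ν`
    obtain ⟨hP, -⟩ := isOrientationPreserving_and_det_trans_refl_prodCongr_threeU φ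
      (LinearMap.BilinForm.IsometryEquiv.neg hyperbolicForm)
    have hw := (isWordIn_nineGenerators_iff _).2 (hP.2 (iff_of_false not_isOrientationPreserving_neg_hyperbolicForm h₁))
    refine ((hw.bind fun s hs ↦ IsWordIn.of_mem (Set.mem_insert_of_mem _ hs)).trans
      (IsWordIn.of_mem (Set.mem_insert _ _))).congr fun v ↦ ?_
    rw [LinearMap.BilinForm.IsometryEquiv.trans_apply, LinearMap.BilinForm.IsometryEquiv.trans_apply]
    refine Prod.ext rfl ?_
    change (LinearMap.BilinForm.IsometryEquiv.neg hyperbolicForm) ((LinearMap.BilinForm.IsometryEquiv.neg hyperbolicForm) (φ v).2) =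
      (φ v).2
    rw [LinearMap.BilinForm.IsometryEquiv.neg_apply, LinearMap.BilinForm.IsometryEquiv.neg_apply, neg_neg]

end Generation

end Literature.Topology.FourManifolds

end
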